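import Literature.Barriers.ValiantsHypothesis.BIJL18Thm6Verifier
import Literature.Computability.Complexity.SchwartzZippelCoinBlocks
import HarnessLib

/-!
# Bläser–Ikenmeyer–Jindal–Lysikov 2018, Thm. 6 — semantics of the verifier: the certificate
# language `L′` and `L′ ∈ coRP` (Schwartz–Zippel over `𝔽_p`)

File 5 of the route to `BIJL2018_thm6`. The verifier `Thm6Verifier.verifF` (`BIJL18Thm6Verifier.lean`)
reads an instance `z`, a witness `u = ⟨bin p, W⟩` and coins; here its numeric checks are translated
into algebra over `ZMod p`:

* `wordPoly p n w ∈ 𝔽_p[x_{ab} : a, b < n]` — the MATRIX POLYNOMIAL of a code `w`: the polynomial of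
  the circuit read off `w` (`CircuitCode.rdCircuit |w| w`), reduced mod `p`, its variable `k` sent to
  the layout variable `PermanentChain.varAtFlat n k` (`x_{(k/n, k%n)}`, or `0` past `n²`);
* the evaluation lemmas `cast_fitEval`, `cast_minorEval`, `cast_coefBlock`, `cast_entryEval`: every
  `evalAtF` term of the verifier, cast into `𝔽_p`, is an evaluation of `wordPoly` (at the random
  matrix `ModularZeroTest.matrixPt`, at its minor substitution `PermanentChain.minorSubst`, at the
  parsed `0/1` matrix);
* `Good z pb W` — the SEMANTIC certificate condition: the deterministic checks and the
  Kabanets–Impagliazzo identities `Q₀ = 1`, `Q_{i+1} = levelRHS i Q_i` AS POLYNOMIAL IDENTITIES over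
  `𝔽_p`, and `Q_n(A) = v`; `semLang = L′ = {⟨z, ⟨pb, W⟩⟩ | Good z pb W}`;
* **`verifF'`** (= `verifF` guarded by a well-pairedness test) accepts every coin string on `L′`
  (`verifF'_accepts_of_good`) and, off `L′`, accepts with probability `≤ 1/2`
  (`uniformProb_accept_le_half`: a failing identity is a nonzero polynomial of degree `≤ n + 1`
  vanishing at the random matrix — `ModularZeroTest.uniformProb_eval_matrixPt_zmod_eq_zero_le`, the
  formal-degree guards bounding degrees through `ArithCircuit.totalDegree_eval_le_formalDegree`);
* **`semLang_mem_coRP : semLang ∈ coRP`**, `semLang_mem_BPP`.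

The graph presentation (`permanent01Graph = ∃u · L′`) and the assembly of Thm. 6 are in
`BIJL18Thm6Holds.lean`. HONEST FRAMING: analysis of the verifier of a published CONDITIONAL barrier
theorem; `VP ≠ VNP` is NOT proved and nothing here bears on it.

## References

* M. Bläser, C. Ikenmeyer, G. Jindal, V. Lysikov, STOC 2018 = ECCC TR18-064, Thm. 6 and §6 (proof,
  p.19) [BlaserIkenmeyerJindalLysikov2018].
* V. Kabanets, R. Impagliazzo, STOC 2003, Lemma 11 (p. 358) [KabanetsImpagliazzo2003].
* S. Arora, B. Barak, CUP 2009, Lemma 7.5 (Schwartz–Zippel), Def. 7.6 (`RP`, `coRP`) [AroraBarakCC2009].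
-/

noncomputable section

namespace Literature.Barriers.ValiantsHypothesis

namespace Thm6Verifier

open Literature.Computability.Complexity Literature.Computability.AlgebraicComplexity
open Literature.Computability.QuantumComplexity
open _root_.Computability Brick ModularZeroTest PointSeg CircuitCode PermanentChain MvPolynomial

/-! ### Integer values of the evaluation terms -/

/-- Transport of the integer value along an equality of variable counts (the code semantics
`semPoly` is typed with `X.eval |w|` variables). [folklore] -/
private theorem rd_eval_transport {V V' : ℕ} (h : V = V') (b : ℕ) (seg w : List Bool) :
    MvPolynomial.eval (ptOf b V seg) (rdCircuit V w).eval = MvPolynomial.eval (ptOf b V' seg) (rdCircuit V' w).eval := by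
  subst h; rfl

/-- **The value of an evaluation term, `|w|` variables**: `⟦evalAtF (mkCtx (bin p) w seg 1^b)⟧ =
((rdCircuit |w| w)(ptOf b |w| seg) mod p)`. [cite: Schwartz1980, §3] -/
theorem bitsToNat_evalWord' {p b : ℕ} (hp : 2 ≤ p) (w seg : List Bool) (hseg : seg.length = w.length * b) :
    bitsToNat (evalAtF (mkCtx (encodeNat p) w seg (ones b))) =
      ((MvPolynomial.eval (ptOf b w.length seg) (rdCircuit w.length w).eval) % (p : ℤ)).toNat := by
  have h := bitsToNat_evalWord hp w seg hseg
  rw [semPoly, rd_eval_transport (Polynomial.eval_X (x := w.length))] at h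
  exact h

/-- An evaluation term has value `< p`. [cite: AroraBarakCC2009, §1.3] -/
theorem bitsToNat_evalWord_lt {p b : ℕ} (hp : 2 ≤ p) (w seg : List Bool) (hseg : seg.length = w.length * b) :
    bitsToNat (evalAtF (mkCtx (encodeNat p) w seg (ones b))) < p := by
  have h := bitsToNat_evalAtF_lt (encodeNat p) w seg b (by rwa [bitsToNat_encodeNat])
    (by rwa [Polynomial.eval_X])
  rwa [bitsToNat_encodeNat] at h

/-- Casting `(v mod p)` (as a natural number) into `ZMod p` gives `v`. [folklore] -/
private theorem cast_emod_toNat {p : ℕ} (hp : 0 < p) (v : ℤ) : (((v % (p : ℤ)).toNat : ℕ) : ZMod p) = (v : ZMod p) := by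
  have h0 : 0 ≤ v % (p : ℤ) := Int.emod_nonneg _ (by exact_mod_cast hp.ne')
  rw [← ZMod.intCast_mod v p, ← Int.toNat_of_nonneg h0, Int.cast_natCast, Int.toNat_of_nonneg h0]

/-! ### The matrix polynomial of a code -/

variable (p n : ℕ)

/-- **The matrix polynomial of a code `w`** in the `n × n` layout over `𝔽_p`: the polynomial of
`rdCircuit |w| w`, reduced modulo `p`, with variable `k` replaced by `varAtFlat n k`
(`x_{(k/n, k%n)}` for `k < n²`, else `0`). [cite: BlaserIkenmeyerJindalLysikov2018, §6 (proof of Thm. 5: "a polynomial computing `per_k`" over `𝔽_p`)] -/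
def wordPoly (w : List Bool) : MvPolynomial (Fin n × Fin n) (ZMod p) :=
  aeval (fun k : Fin w.length => varAtFlat (ZMod p) n k.val)
    (MvPolynomial.map (Int.castRingHom (ZMod p)) (rdCircuit w.length w).eval)

variable {p n}

/-- Substituting polynomials of total degree `≤ 1` does not increase the total degree (private copy of
`Literature.Barriers.ValiantsHypothesis.totalDegree_aeval_le_of_forall_le_one`, heavier import cone). [folklore] -/
private theorem totalDegree_aeval_le_of_forall_le_one' {F σ τ : Type*} [CommRing F] (P : MvPolynomial σ F)
    {θ : σ → MvPolynomial τ F} (hθ : ∀ i, (θ i).totalDegree ≤ 1) :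
    (aeval θ P).totalDegree ≤ P.totalDegree := by
  classical
  rw [MvPolynomial.aeval_eq_bind₁]
  have hsum : MvPolynomial.bind₁ θ P =
      ∑ e ∈ P.support, MvPolynomial.bind₁ θ (monomial e (coeff e P)) := by
    conv_lhs => rw [P.as_sum]
    rw [map_sum]
  rw [hsum]
  refine totalDegree_finsetSum_le fun e he => ?_
  rw [bind₁_monomial]
  refine (totalDegree_mul _ _).trans ?_
  rw [totalDegree_C, zero_add]
  refine (totalDegree_finsetProd _ _).trans ?_
  refine le_trans (Finset.sum_le_sum fun i _ => (totalDegree_pow _ _).trans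
    (Nat.mul_le_mul_left (e i) (hθ i))) ?_
  simp only [mul_one]
  exact le_totalDegree he

/-- Base change does not increase the total degree. [folklore] -/
private theorem totalDegree_map_le'' {R S σ : Type*} [CommSemiring R] [CommSemiring S]
    (f : R →+* S) (q : MvPolynomial σ R) : (MvPolynomial.map f q).totalDegree ≤ q.totalDegree :=
  Finset.sup_mono (support_map_subset f q)

/-- **The matrix polynomial has degree at most the formal degree of the circuit read off `w`.**
[cite: BlaserIkenmeyerJindalLysikov2018, §6 (proof of Thm. 5, step 2)] -/
theorem totalDegree_wordPoly_le (w : List Bool) :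
    (wordPoly p n w).totalDegree ≤ (rdCircuit w.length w).formalDegree :=
  (totalDegree_aeval_le_of_forall_le_one' _ fun _ => totalDegree_varAtFlat_le _).trans
    ((totalDegree_map_le'' _ _).trans (ArithCircuit.totalDegree_eval_le_formalDegree _))

/-- **Evaluation of the matrix polynomial**: if a point `G` of `𝔽_p^{n×n}` and an integer point `pt`
of the circuit's variables agree through the layout (`(varAtFlat k)(G) = pt k mod p`), then
`wordPoly(G) = (rdCircuit |w| w)(pt) mod p`. [cite: BlaserIkenmeyerJindalLysikov2018, §6 (random evaluation over `𝔽_p`)] -/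
theorem eval_wordPoly_of_pt (w : List Bool) (G : Fin n × Fin n → ZMod p) (pt : Fin w.length → ℤ)
    (hpt : ∀ k : Fin w.length, MvPolynomial.eval G (varAtFlat (ZMod p) n k.val) = ((pt k : ℤ) : ZMod p)) :
    MvPolynomial.eval G (wordPoly p n w) =
      ((MvPolynomial.eval pt (rdCircuit w.length w).eval : ℤ) : ZMod p) := by
  rw [wordPoly, show MvPolynomial.eval G (aeval (fun k : Fin w.length => varAtFlat (ZMod p) n k.val)
      (MvPolynomial.map (Int.castRingHom (ZMod p)) (rdCircuit w.length w).eval)) =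
    aeval G (aeval (fun k : Fin w.length => varAtFlat (ZMod p) n k.val)
      (MvPolynomial.map (Int.castRingHom (ZMod p)) (rdCircuit w.length w).eval)) from rfl,
    ← AlgHom.comp_apply, comp_aeval]
  have hfun : (fun k : Fin w.length => aeval G (varAtFlat (ZMod p) n k.val)) =
      (Int.castRingHom (ZMod p)) ∘ pt := by
    funext k; exact hpt k
  rw [show aeval (fun k : Fin w.length => aeval G (varAtFlat (ZMod p) n k.val))
      (MvPolynomial.map (Int.castRingHom (ZMod p)) (rdCircuit w.length w).eval) =
    MvPolynomial.eval (fun k : Fin w.length => aeval G (varAtFlat (ZMod p) n k.val))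
      (MvPolynomial.map (Int.castRingHom (ZMod p)) (rdCircuit w.length w).eval) from rfl,
    hfun, MvPolynomial.eval_map]
  change _ = Int.castRingHom (ZMod p) (MvPolynomial.eval₂ (RingHom.id ℤ) pt (rdCircuit w.length w).eval)
  rw [MvPolynomial.eval₂_comp_left, RingHom.comp_id]

/-! ### The three evaluation points, cast into `𝔽_p` -/

/-- The value of `varAtFlat k` at the random matrix read off the coins: `⟦block k⟧` for `k < n²`,
else `0`. [cite: BlaserIkenmeyerJindalLysikov2018, §6 (random evaluation over `𝔽_p`)] -/
theorem eval_varAtFlat_matrixPt (b : ℕ) (y : List Bool) (k : ℕ) :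
    MvPolynomial.eval (matrixPt (Nat.cast : ℕ → ZMod p) b n y) (varAtFlat (ZMod p) n k) =
      if k < n * n then ((bitsToNat (blockOf b k y) : ℕ) : ZMod p) else 0 := by
  rw [eval_varAtFlat]
  split_ifs with h
  · simp only [matrixPt]
    rw [Nat.div_add_mod' k n]
  · rfl

/-- **The random-matrix evaluation**: `⟦w_i(R)⟧ mod p = wordPoly(w_i)(R̄)` (`R̄` the matrix point of
the coins in `𝔽_p`, `2 ≤ p`, at least `n²b` coins). [cite: BlaserIkenmeyerJindalLysikov2018, §6 (random evaluation over `𝔽_p`)] -/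
theorem cast_fitEval {p n : ℕ} (hp : 2 ≤ p) {y : List Bool} (hy : n * n * bOf n ≤ y.length) (W : List Bool) (i : ℕ) :
    ((bitsToNat (fitEval (bOf n) p (y.take (n * n * bOf n)) W i) : ℕ) : ZMod p) =
      MvPolynomial.eval (matrixPt (Nat.cast : ℕ → ZMod p) (bOf n) n y) (wordPoly p n (fstF (sndF^[i] W))) := by
  set w := fstF (sndF^[i] W) with hw
  have hT : (y.take (n * n * bOf n)).length = n * n * bOf n := by rw [List.length_take]; exact min_eq_left hy
  obtain ⟨hlen, hpt⟩ := ptOf_fitSegF (V := w.length) (b := bOf n) (m := n * n) (T := y.take (n * n * bOf n)) hT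
  rw [fitEval, ← hw, bitsToNat_evalWord' hp w _ hlen, cast_emod_toNat (by omega),
    eval_wordPoly_of_pt w _ (ptOf (bOf n) w.length (fitSegF (boolPair (ones w.length) (boolPair (ones (bOf n))
      (y.take (n * n * bOf n))))))]
  intro k
  rw [eval_varAtFlat_matrixPt, hpt k]
  split_ifs with h
  · rw [blockOf_take h]; push_cast; rfl
  · push_cast; rfl

/-- Past `n²` the minor sources are past `n²` as well. [folklore] -/
private theorem minorSrc_ge {n j k : ℕ} (hk : ¬ k < n * n) : ¬ minorSrc n j (k / n) (k % n) < n * n := by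
  intro h
  unfold minorSrc at h
  rcases Nat.eq_zero_or_pos n with rfl | hn
  · simp at h
  · have h1 : n ≤ k / n := (Nat.le_div_iff_mul_le hn).2 (not_lt.1 hk)
    have h2 : n * n ≤ (k / n + 1) * n := Nat.mul_le_mul_right n (by omega)
    omega

/-- **The minor evaluation**: `⟦w_i(minor_j R)⟧ mod p = (minorSubst j (wordPoly w_i))(R̄)`.
[cite: KabanetsImpagliazzo2003, Lemma 11 (2) (p. 358)] [cite: BlaserIkenmeyerJindalLysikov2018, §6 (random evaluation over `𝔽_p`)] -/
theorem cast_minorEval {p n : ℕ} (hp : 2 ≤ p) {y : List Bool} (hy : n * n * bOf n ≤ y.length) (W : List Bool) (i j : ℕ) :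
    ((bitsToNat (minorEval n (bOf n) p (y.take (n * n * bOf n)) W i j) : ℕ) : ZMod p) =
      MvPolynomial.eval (matrixPt (Nat.cast : ℕ → ZMod p) (bOf n) n y)
        (minorSubst (ZMod p) n j (wordPoly p n (fstF (sndF^[i] W)))) := by
  set w := fstF (sndF^[i] W) with hw
  have hT : (y.take (n * n * bOf n)).length = n * n * bOf n := by rw [List.length_take]; exact min_eq_left hy
  obtain ⟨hlen, hpt⟩ := ptOf_minorSegF (V := w.length) (b := bOf n) (m := n * n) (n := n) (j := j)
    (T := y.take (n * n * bOf n)) hT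
  rw [minorEval, ← hw, bitsToNat_evalWord' hp w _ hlen, cast_emod_toNat (by omega), eval_minorSubst,
    eval_wordPoly_of_pt w _ (ptOf (bOf n) w.length (minorSegF (boolPair (ones w.length) (boolPair (ones (bOf n))
      (boolPair (y.take (n * n * bOf n)) (boolPair (ones n) (ones j)))))))]
  intro k
  rw [eval_varAtFlat, hpt k]
  by_cases h : k.val < n * n
  · rw [dif_pos h]
    simp only
    rw [eval_varAtFlat_matrixPt]
    split_ifs with hs
    · rw [blockOf_take hs]; push_cast; rfl
    · push_cast; rfl
  · rw [dif_neg h, if_neg (minorSrc_ge h)]; push_cast; rfl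

/-- **The coefficient**: `⟦block j⟧ mod p = x_{0j}(R̄) = (varAtFlat j)(R̄)` for `j < n`.
[cite: KabanetsImpagliazzo2003, Lemma 11 (2) (p. 358)] -/
theorem cast_coefBlock {p n : ℕ} {y : List Bool} (hy : n * n * bOf n ≤ y.length) {j : ℕ} (hj : j < n) :
    ((bitsToNat (coefBlock (bOf n) (y.take (n * n * bOf n)) j) : ℕ) : ZMod p) =
      MvPolynomial.eval (matrixPt (Nat.cast : ℕ → ZMod p) (bOf n) n y) (varAtFlat (ZMod p) n j) := by
  have hT : (y.take (n * n * bOf n)).length = n * n * (ones (bOf n)).length := by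
    rw [List.length_take, KIReduction.length_ones']; exact min_eq_left hy
  have hjn : j < n * n := lt_of_lt_of_le hj (Nat.le_mul_self n)
  rw [coefBlock, bitsToNat_blockAtF (m := n * n) hT, KIReduction.length_ones', KIReduction.length_ones', if_pos hjn,
    eval_varAtFlat_matrixPt, if_pos hjn, blockOf_take hjn]

/-- **The entry evaluation**: `⟦w(A)⟧ mod p = wordPoly(w)(Ā)`, `Ā` the parsed `0/1` matrix cast into
`𝔽_p`. [cite: KabanetsImpagliazzo2003, proof of Cor. 12 (p. 358)] -/
theorem cast_entryEval {p n : ℕ} (hp : 2 ≤ p) (rows w : List Bool) :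
    ((bitsToNat (evalAtF (mkCtx (encodeNat p) w (entrySegF (boolPair (ones w.length) (boolPair (ones (bOf n))
        (boolPair rows (ones n))))) (ones (bOf n)))) : ℕ) : ZMod p) =
      MvPolynomial.eval (fun ac : Fin n × Fin n => ((KIReduction.parsedEntry rows ac.1.val ac.2.val : ℤ) : ZMod p))
        (wordPoly p n w) := by
  obtain ⟨hlen, hpt⟩ := ptOf_entrySegF (V := w.length) (b := bOf n) (n := n) (by rw [bOf]; omega) rows
  rw [bitsToNat_evalWord' hp w _ hlen, cast_emod_toNat (by omega),
    eval_wordPoly_of_pt w _ (ptOf (bOf n) w.length (entrySegF (boolPair (ones w.length) (boolPair (ones (bOf n))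
      (boolPair rows (ones n))))))]
  intro k
  rw [eval_varAtFlat, hpt k]
  by_cases h : k.val < n * n
  · rw [dif_pos h, if_pos h]
  · rw [dif_neg h, if_neg h]; push_cast; rfl

/-! ### The level conditions as evaluation identities -/

/-- `ℕ → 𝔽_p` is injective below `p`: `a = s mod p ↔ (a : 𝔽_p) = s` for `a < p`. [folklore] -/
private theorem eq_mod_iff_cast_eq {p a s : ℕ} (ha : a < p) : a = s % p ↔ (a : ZMod p) = (s : ZMod p) := by
  constructor
  · intro h; rw [h, ZMod.natCast_mod]
  · intro h
    rw [ZMod.natCast_eq_natCast_iff'] at h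
    rw [Nat.mod_eq_of_lt ha] at h
    exact h

/-- **Level `0` as an identity**: `⟦w_0(R)⟧ = 1 ↔ wordPoly(w_0)(R̄) = 1`. [cite: KabanetsImpagliazzo2003, Lemma 11 (1) (p. 358)] -/
theorem fitEval_zero_iff {p n : ℕ} (hp : 2 ≤ p) {y : List Bool} (hy : n * n * bOf n ≤ y.length) (W : List Bool) :
    bitsToNat (fitEval (bOf n) p (y.take (n * n * bOf n)) W 0) = 1 ↔
      MvPolynomial.eval (matrixPt (Nat.cast : ℕ → ZMod p) (bOf n) n y) (wordPoly p n (fstF W)) = 1 := by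
  have hT : (y.take (n * n * bOf n)).length = n * n * bOf n := by rw [List.length_take]; exact min_eq_left hy
  have hlt : bitsToNat (fitEval (bOf n) p (y.take (n * n * bOf n)) W 0) < p := by
    rw [fitEval]
    exact bitsToNat_evalWord_lt hp _ _ (ptOf_fitSegF (V := (fstF (sndF^[0] W)).length) (m := n * n) hT).1
  have hc := cast_fitEval hp hy W 0
  rw [Function.iterate_zero_apply] at hc
  rw [← hc, ← Nat.cast_one (R := ZMod p), ← eq_mod_iff_cast_eq hlt, Nat.mod_eq_of_lt (by omega : 1 < p)]

/-- **Level `i+1` as an identity** (`i < n`): `⟦w_{i+1}(R)⟧ = (Σ_{j≤i} ⟦block j⟧·⟦w_i(minor_j R)⟧) mod p ↔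
wordPoly(w_{i+1})(R̄) = (levelRHS i (wordPoly w_i))(R̄)`. [cite: KabanetsImpagliazzo2003, Lemma 11 (2) (p. 358)] -/
theorem fitEval_succ_iff {p n : ℕ} (hp : 2 ≤ p) {y : List Bool} (hy : n * n * bOf n ≤ y.length) (W : List Bool)
    {i : ℕ} (hi : i < n) :
    bitsToNat (fitEval (bOf n) p (y.take (n * n * bOf n)) W (i + 1)) =
        (∑ j ∈ Finset.range (i + 1), bitsToNat (coefBlock (bOf n) (y.take (n * n * bOf n)) j) *
          bitsToNat (minorEval n (bOf n) p (y.take (n * n * bOf n)) W i j)) % p ↔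
      MvPolynomial.eval (matrixPt (Nat.cast : ℕ → ZMod p) (bOf n) n y) (wordPoly p n (fstF (sndF^[i + 1] W))) =
        MvPolynomial.eval (matrixPt (Nat.cast : ℕ → ZMod p) (bOf n) n y)
          (levelRHS (ZMod p) n i (wordPoly p n (fstF (sndF^[i] W)))) := by
  have hT : (y.take (n * n * bOf n)).length = n * n * bOf n := by rw [List.length_take]; exact min_eq_left hy
  have hlt : bitsToNat (fitEval (bOf n) p (y.take (n * n * bOf n)) W (i + 1)) < p := by
    rw [fitEval]
    exact bitsToNat_evalWord_lt hp _ _ (ptOf_fitSegF (V := (fstF (sndF^[i + 1] W)).length) (m := n * n) hT).1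
  rw [eq_mod_iff_cast_eq hlt, cast_fitEval hp hy W (i + 1)]
  have hrhs : ((∑ j ∈ Finset.range (i + 1), bitsToNat (coefBlock (bOf n) (y.take (n * n * bOf n)) j) *
      bitsToNat (minorEval n (bOf n) p (y.take (n * n * bOf n)) W i j) : ℕ) : ZMod p) =
      MvPolynomial.eval (matrixPt (Nat.cast : ℕ → ZMod p) (bOf n) n y)
        (levelRHS (ZMod p) n i (wordPoly p n (fstF (sndF^[i] W)))) := by
    rw [levelRHS, map_sum]
    push_cast
    refine Finset.sum_congr rfl fun j hj => ?_
    rw [Finset.mem_range] at hj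
    rw [map_mul, cast_coefBlock hy (by omega), cast_minorEval hp hy W i j]
  rw [hrhs]

/-- **The final check as an identity**: `⟦w(A)⟧ = v ↔ wordPoly(w)(Ā) = v` for `v < p`.
[cite: KabanetsImpagliazzo2003, proof of Cor. 12 (p. 358)] -/
theorem entryEval_iff {p n v : ℕ} (hp : 2 ≤ p) (hv : v < p) (rows w : List Bool) :
    bitsToNat (evalAtF (mkCtx (encodeNat p) w (entrySegF (boolPair (ones w.length) (boolPair (ones (bOf n))
        (boolPair rows (ones n))))) (ones (bOf n)))) = v ↔
      MvPolynomial.eval (fun ac : Fin n × Fin n => ((KIReduction.parsedEntry rows ac.1.val ac.2.val : ℤ) : ZMod p))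
        (wordPoly p n w) = (v : ZMod p) := by
  have hlen := (ptOf_entrySegF (V := w.length) (b := bOf n) (n := n) (by rw [bOf]; omega) rows).1
  have hlt := bitsToNat_evalWord_lt hp w _ hlen
  rw [← cast_entryEval hp rows w, ← eq_mod_iff_cast_eq hlt, Nat.mod_eq_of_lt hv]

/-! ### The certificate language `L′` -/

/-- **The semantic certificate condition** on `⟨z, ⟨pb, W⟩⟩` (`n = nOf`, `p = ⟦pb⟧`, `w_i` the `i`-th
code): the instance is canonical, `p` prime, `v < p`, `2^{n²+2} ≤ p`, the formal-degree guards
(`rd w_0 ≤ 1`, `rd w_{i+1} ≤ i + 1`), and the Kabanets–Impagliazzo identities AS POLYNOMIAL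
IDENTITIES over `𝔽_p` in the layout — `wordPoly w_0 = 1`, `wordPoly w_{i+1} = levelRHS i (wordPoly w_i)`
(`i < n`) — and `wordPoly w_n (A) = v`. [cite: BlaserIkenmeyerJindalLysikov2018, Thm. 6 (proof, §6 p.19)]
[cite: KabanetsImpagliazzo2003, Lemma 11 (p. 358)] -/
def Good (z pb W : List Bool) : Prop :=
  fstF (boolPair z (boolPair pb W)) = KIReduction.canonX (boolPair z (boolPair pb W)) ∧ (bitsToNat pb).Prime ∧
  KIReduction.vOf (boolPair z (boolPair pb W)) < bitsToNat pb ∧ 2 ^ bOf (KIReduction.nOf (boolPair z (boolPair pb W))) ≤ bitsToNat pb ∧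
  (rdCircuit (fstF W).length (fstF W)).formalDegree ≤ 1 ∧
  (∀ i < KIReduction.nOf (boolPair z (boolPair pb W)),
    (rdCircuit (fstF (sndF^[i + 1] W)).length (fstF (sndF^[i + 1] W))).formalDegree ≤ i + 1) ∧
  wordPoly (bitsToNat pb) (KIReduction.nOf (boolPair z (boolPair pb W))) (fstF W) = 1 ∧
  (∀ i < KIReduction.nOf (boolPair z (boolPair pb W)),
    wordPoly (bitsToNat pb) (KIReduction.nOf (boolPair z (boolPair pb W))) (fstF (sndF^[i + 1] W)) =
      levelRHS (ZMod (bitsToNat pb)) (KIReduction.nOf (boolPair z (boolPair pb W))) i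
        (wordPoly (bitsToNat pb) (KIReduction.nOf (boolPair z (boolPair pb W))) (fstF (sndF^[i] W)))) ∧
  MvPolynomial.eval (fun ac : Fin (KIReduction.nOf (boolPair z (boolPair pb W))) × Fin (KIReduction.nOf (boolPair z (boolPair pb W))) =>
      ((KIReduction.parsedEntry (KIReduction.rowsStr (boolPair z (boolPair pb W))) ac.1.val ac.2.val : ℤ) : ZMod (bitsToNat pb)))
    (wordPoly (bitsToNat pb) (KIReduction.nOf (boolPair z (boolPair pb W))) (fstF (sndF^[KIReduction.nOf (boolPair z (boolPair pb W))] W))) =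
    (KIReduction.vOf (boolPair z (boolPair pb W)) : ZMod (bitsToNat pb))

/-- **The certificate language `L′`**: well-paired records `⟨z, ⟨pb, W⟩⟩` satisfying `Good`.
[cite: BlaserIkenmeyerJindalLysikov2018, Thm. 6 (proof, §6 p.19)] -/
def semLang : Language Bool := {x | ∃ z pb W, x = boolPair z (boolPair pb W) ∧ Good z pb W}

/-- **The well-pairedness test** on `⟨x, y⟩`: `[x = ⟨fstF x, ⟨fstF (sndF x), sndF (sndF x)⟩⟩]`. [folklore] -/
def wfF : List Bool → List Bool :=
  eqPairFn ∘ fanoutFn id (fanoutFn fstF (fanoutFn (fstF ∘ sndF) (sndF ∘ sndF))) ∘ fstF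

/-- **The guarded verifier**: reject ill-paired inputs, otherwise run `verifF`. [cite: BlaserIkenmeyerJindalLysikov2018, Thm. 6 (proof, §6 p.19)] -/
def verifF' : List Bool → List Bool := andFn wfF verifF

/-- `wfF ∈ FP`. [folklore] -/
private theorem wfF_mem_FP : wfF ∈ FP :=
  comp_mem_FP eqPairFn_mem_FP (comp_mem_FP (fanoutFn_mem_FP OracleCompose.id_mem_FP (fanoutFn_mem_FP fstF_mem_FP
    (fanoutFn_mem_FP (comp_mem_FP fstF_mem_FP sndF_mem_FP) (comp_mem_FP sndF_mem_FP sndF_mem_FP)))) fstF_mem_FP)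

/-- **`verifF' ∈ FP`.** [cite: AroraBarakCC2009, §1.3] -/
theorem verifF'_mem_FP : verifF' ∈ FP := andFn_mem_FP wfF_mem_FP verifF_mem_FP

/-- `wfF` is one-bit with value `[x = repaired x]`. [folklore] -/
private theorem wfF_apply (x y : List Bool) :
    wfF (boolPair x y) = [decide (x = boolPair (fstF x) (boolPair (fstF (sndF x)) (sndF (sndF x))))] := by
  rw [wfF, Function.comp_apply, Function.comp_apply, fstF_boolPair, fanoutFn_apply, eqPairFn_boolPair]
  simp

/-- `wfF` is one-bit. [folklore] -/
private theorem oneBit_wfF : OneBit wfF := fun s =>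
  ⟨_, by rw [wfF, Function.comp_apply, Function.comp_apply, fanoutFn_apply, eqPairFn_boolPair]⟩

/-- The rejection bit `¬ verifF'`. [folklore] -/
def rejF : List Bool → List Bool := notFn verifF'

/-- `verifF` as a `OneBit` function. [folklore] -/
private theorem oneBit_verifF : OneBit verifF := fun s => by
  rcases verifF_oneBit s with h | h
  · exact ⟨true, h⟩
  · exact ⟨false, h⟩

/-- **The guarded verifier is one-bit.** [cite: AroraBarakCC2009, §1.3] -/
theorem verifF'_oneBit (s : List Bool) : verifF' s = [true] ∨ verifF' s = [false] := by
  obtain ⟨b, hb⟩ := oneBit_andFn oneBit_wfF oneBit_verifF s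
  rw [verifF', hb]; cases b
  · exact Or.inr rfl
  · exact Or.inl rfl

/-- `rejF ∈ FP`. [folklore] -/
private theorem rejF_mem_FP : rejF ∈ FP := notFn_mem_FP verifF'_mem_FP

/-- `rejF s = [true] ↔ verifF' s = [false]`. [folklore] -/
private theorem rejF_eq_true_iff (s : List Bool) : rejF s = [true] ↔ verifF' s = [false] := by
  rcases verifF'_oneBit s with h | h
  · rw [rejF, notFn_apply h, h]; simp
  · rw [rejF, notFn_apply h, h]; simp

/-- **`verifF'` on a well-paired input is `verifF`.** [cite: AroraBarakCC2009, §1.3] -/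
theorem verifF'_inst (z pb W y : List Bool) :
    verifF' (boolPair (boolPair z (boolPair pb W)) y) = verifF (boolPair (boolPair z (boolPair pb W)) y) := by
  have hw : wfF (boolPair (boolPair z (boolPair pb W)) y) = [true] := by rw [wfF_apply]; simp
  obtain ⟨b, hb⟩ := oneBit_verifF (boolPair (boolPair z (boolPair pb W)) y)
  rw [verifF', andFn_apply hw hb, hb]; simp

/-- **`verifF'` rejects ill-paired inputs.** [cite: AroraBarakCC2009, §1.3] -/
theorem verifF'_of_not_wf {x : List Bool} (hx : ∀ z pb W, x ≠ boolPair z (boolPair pb W)) (y : List Bool) :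
    verifF' (boolPair x y) = [false] := by
  have hw : wfF (boolPair x y) = [false] := by
    rw [wfF_apply]
    simp only [List.cons.injEq, and_true, decide_eq_false_iff_not]
    exact hx _ _ _
  obtain ⟨b, hb⟩ := oneBit_verifF (boolPair x y)
  rw [verifF', andFn_apply hw hb]; simp

/-! ### Completeness of one round: `L′` is always accepted -/

/-- **On `L′` every coin string is accepted** (enough coins). [cite: BlaserIkenmeyerJindalLysikov2018, Thm. 6 (proof, §6 p.19)]
[cite: KabanetsImpagliazzo2003, Lemma 11 (p. 358)] -/
theorem verifF_accepts_of_good {z pb W : List Bool} (hg : Good z pb W) {y : List Bool}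
    (hy : KIReduction.nOf (boolPair z (boolPair pb W)) * KIReduction.nOf (boolPair z (boolPair pb W)) * bOf (KIReduction.nOf (boolPair z (boolPair pb W))) ≤ y.length) :
    verifF (boolPair (boolPair z (boolPair pb W)) y) = [true] := by
  obtain ⟨h1, h2, h3, h4, h5, h6, h7, h8, h9⟩ := hg
  have hp : 2 ≤ bitsToNat pb := h2.two_le
  rw [verifF_eq_true_iff (z := z) (pb := pb) (W := W) (y := y) hy]
  refine ⟨h1, h2, h3, h4, ⟨h5, ?_⟩, fun i hi => ⟨h6 i hi, ?_⟩, ?_⟩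
  · rw [fitEval_zero_iff hp hy, h7, map_one]
  · rw [fitEval_succ_iff hp hy W hi, h8 i hi]
  · rw [entryEval_iff hp h3]; exact h9

/-! ### Soundness of one round: off `L′`, acceptance forces a nonzero polynomial to vanish -/

/-- **The bad polynomial of a rejected certificate.** For a well-paired `x = ⟨z, ⟨pb, W⟩⟩` with all
DETERMINISTIC conditions of `Good` but not `Good` itself, some identity fails; this is a nonzero
polynomial `h` of total degree `≤ n + 1` such that every accepting coin string makes `h` vanish at
the random matrix. [cite: BlaserIkenmeyerJindalLysikov2018, Thm. 6 (proof, §6 p.19)] [cite: AroraBarakCC2009, Lemma 7.5] -/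
theorem exists_badPoly {z pb W : List Bool} (hng : ¬ Good z pb W)
    (h1 : fstF (boolPair z (boolPair pb W)) = KIReduction.canonX (boolPair z (boolPair pb W))) (h2 : (bitsToNat pb).Prime)
    (h3 : KIReduction.vOf (boolPair z (boolPair pb W)) < bitsToNat pb) (h4 : 2 ^ bOf (KIReduction.nOf (boolPair z (boolPair pb W))) ≤ bitsToNat pb)
    (h5 : (rdCircuit (fstF W).length (fstF W)).formalDegree ≤ 1)
    (h6 : ∀ i < KIReduction.nOf (boolPair z (boolPair pb W)),
      (rdCircuit (fstF (sndF^[i + 1] W)).length (fstF (sndF^[i + 1] W))).formalDegree ≤ i + 1)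
    (h9 : MvPolynomial.eval (fun ac : Fin (KIReduction.nOf (boolPair z (boolPair pb W))) × Fin (KIReduction.nOf (boolPair z (boolPair pb W))) =>
        ((KIReduction.parsedEntry (KIReduction.rowsStr (boolPair z (boolPair pb W))) ac.1.val ac.2.val : ℤ) : ZMod (bitsToNat pb)))
      (wordPoly (bitsToNat pb) (KIReduction.nOf (boolPair z (boolPair pb W))) (fstF (sndF^[KIReduction.nOf (boolPair z (boolPair pb W))] W))) =
      (KIReduction.vOf (boolPair z (boolPair pb W)) : ZMod (bitsToNat pb))) :
    ∃ h : MvPolynomial (Fin (KIReduction.nOf (boolPair z (boolPair pb W))) × Fin (KIReduction.nOf (boolPair z (boolPair pb W)))) (ZMod (bitsToNat pb)),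
      h ≠ 0 ∧ h.totalDegree ≤ KIReduction.nOf (boolPair z (boolPair pb W)) + 1 ∧
      ∀ y : List Bool, KIReduction.nOf (boolPair z (boolPair pb W)) * KIReduction.nOf (boolPair z (boolPair pb W)) * bOf (KIReduction.nOf (boolPair z (boolPair pb W))) ≤
          y.length → verifF (boolPair (boolPair z (boolPair pb W)) y) = [true] →
        MvPolynomial.eval (matrixPt (Nat.cast : ℕ → ZMod (bitsToNat pb)) (bOf (KIReduction.nOf (boolPair z (boolPair pb W))))
          (KIReduction.nOf (boolPair z (boolPair pb W))) y) h = 0 := by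
  set n := KIReduction.nOf (boolPair z (boolPair pb W)) with hn
  set p := bitsToNat pb with hpdef
  have hp : 2 ≤ p := h2.two_le
  by_cases h7 : wordPoly p n (fstF W) = 1
  · -- some level identity fails
    have h8 : ¬ ∀ i < n, wordPoly p n (fstF (sndF^[i + 1] W)) = levelRHS (ZMod p) n i (wordPoly p n (fstF (sndF^[i] W))) :=
      fun h8 => hng ⟨h1, h2, h3, h4, h5, h6, h7, h8, h9⟩
    push Not at h8
    obtain ⟨i, hi, hne⟩ := h8
    refine ⟨wordPoly p n (fstF (sndF^[i + 1] W)) - levelRHS (ZMod p) n i (wordPoly p n (fstF (sndF^[i] W))),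
      sub_ne_zero.2 hne, ?_, fun y hy hacc => ?_⟩
    · refine (totalDegree_sub_levelRHS_le i _ _).trans (max_le ?_ ?_)
      · exact ((totalDegree_wordPoly_le _).trans (h6 i hi)).trans (by omega)
      · have hdi : (rdCircuit (fstF (sndF^[i] W)).length (fstF (sndF^[i] W))).formalDegree ≤ max i 1 := by
          rcases Nat.eq_zero_or_pos i with rfl | hi0
          · exact h5.trans (by simp)
          · obtain ⟨i', rfl⟩ : ∃ i', i = i' + 1 := ⟨i - 1, by omega⟩
            exact (h6 i' (by omega)).trans (by omega)
        have := (totalDegree_wordPoly_le (p := p) (n := n) (fstF (sndF^[i] W))).trans hdi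
        omega
    · rw [verifF_eq_true_iff (z := z) (pb := pb) (W := W) (y := y) hy] at hacc
      obtain ⟨-, -, -, -, -, hall, -⟩ := hacc
      have hl := (fitEval_succ_iff hp hy W hi).1 (hall i hi).2
      rw [map_sub, hl, sub_self]
  · -- level `0` fails
    refine ⟨wordPoly p n (fstF W) - 1, sub_ne_zero.2 h7, ?_, fun y hy hacc => ?_⟩
    · refine (totalDegree_sub _ _).trans (max_le (((totalDegree_wordPoly_le _).trans h5).trans (by omega)) ?_)
      rw [totalDegree_one]; exact Nat.zero_le _
    · rw [verifF_eq_true_iff (z := z) (pb := pb) (W := W) (y := y) hy] at hacc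
      obtain ⟨-, -, -, -, ⟨-, h0⟩, -, -⟩ := hacc
      have hl := (fitEval_zero_iff hp hy W).1 h0
      rw [map_sub, map_one, hl, sub_self]

/-- `n + 1 ≤ 2^{n² + 1}`. [folklore] -/
private theorem succ_le_two_pow_bOf (n : ℕ) : 2 * (n + 1) ≤ 2 ^ bOf n := by
  rw [bOf, pow_succ, pow_succ]
  have h1 : n + 1 ≤ 2 ^ n := Nat.succ_le_of_lt Nat.lt_two_pow_self
  have h2 : 2 ^ n ≤ 2 ^ (n ^ 2) := Nat.pow_le_pow_right (by norm_num) (by nlinarith)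
  omega

/-- **Off `L′` the verifier accepts with probability at most `1/2`** (for a well-paired `x` and any
number `N ≥ n²b` of coins). [cite: BlaserIkenmeyerJindalLysikov2018, Thm. 6 (proof, §6 p.19)] [cite: AroraBarakCC2009, Lemma 7.5] -/
theorem uniformProb_accept_le_half {z pb W : List Bool} (hng : ¬ Good z pb W) {N : ℕ}
    (hN : KIReduction.nOf (boolPair z (boolPair pb W)) * KIReduction.nOf (boolPair z (boolPair pb W)) * bOf (KIReduction.nOf (boolPair z (boolPair pb W))) ≤ N) :
    uniformProb N {y | verifF (boolPair (boolPair z (boolPair pb W)) y) = [true]} ≤ 1 / 2 := by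
  set n := KIReduction.nOf (boolPair z (boolPair pb W)) with hn
  set p := bitsToNat pb with hpdef
  -- if a deterministic condition fails, nothing of length `N` is accepted
  by_cases hdet : fstF (boolPair z (boolPair pb W)) = KIReduction.canonX (boolPair z (boolPair pb W)) ∧ p.Prime ∧
      KIReduction.vOf (boolPair z (boolPair pb W)) < p ∧ 2 ^ bOf n ≤ p ∧
      (rdCircuit (fstF W).length (fstF W)).formalDegree ≤ 1 ∧
      (∀ i < n, (rdCircuit (fstF (sndF^[i + 1] W)).length (fstF (sndF^[i + 1] W))).formalDegree ≤ i + 1) ∧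
      MvPolynomial.eval (fun ac : Fin n × Fin n =>
          ((KIReduction.parsedEntry (KIReduction.rowsStr (boolPair z (boolPair pb W))) ac.1.val ac.2.val : ℤ) : ZMod p))
        (wordPoly p n (fstF (sndF^[n] W))) = (KIReduction.vOf (boolPair z (boolPair pb W)) : ZMod p)
  · obtain ⟨h1, h2, h3, h4, h5, h6, h9⟩ := hdet
    haveI : Fact p.Prime := ⟨h2⟩
    obtain ⟨h, hne, hdeg, hzero⟩ := exists_badPoly hng h1 h2 h3 h4 h5 h6 h9
    have hsub : uniformProb N {y | verifF (boolPair (boolPair z (boolPair pb W)) y) = [true]} ≤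
        uniformProb N {y | MvPolynomial.eval (matrixPt (Nat.cast : ℕ → ZMod p) (bOf n) n y) h = 0} :=
      BPExp.uniformProb_mono_len fun y hy hlen => hzero y (by rw [hlen]; exact hN) hy
    refine hsub.trans ((uniformProb_eval_matrixPt_zmod_eq_zero_le hN h4 hne).trans ?_)
    rw [div_le_div_iff₀ (by positivity) (by norm_num), one_mul]
    have h2n : ((2 * (n + 1) : ℕ) : ℝ) ≤ ((2 ^ bOf n : ℕ) : ℝ) := by exact_mod_cast succ_le_two_pow_bOf n
    have hd : (h.totalDegree : ℝ) ≤ ((n + 1 : ℕ) : ℝ) := by exact_mod_cast hdeg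
    push_cast at h2n hd ⊢
    linarith
  · have hnone : ∀ y : List Bool, y.length = N → y ∉ {y | verifF (boolPair (boolPair z (boolPair pb W)) y) = [true]} := by
      intro y hy hacc
      apply hdet
      rw [Set.mem_setOf_eq, verifF_eq_true_iff (z := z) (pb := pb) (W := W) (y := y) (by rw [hy]; exact hN)] at hacc
      obtain ⟨h1, h2, h3, h4, ⟨h5, -⟩, hall, hfin⟩ := hacc
      exact ⟨h1, h2, h3, h4, h5, fun i hi => (hall i hi).1, (entryEval_iff h2.two_le h3 _ _).1 hfin⟩
    rw [BPExp.uniformProb_eq_zero_of_forall hnone]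
    norm_num

/-! ### `L′ ∈ coRP` -/

/-- **The coin polynomial**: `N(m) = m⁴ + 2m²` coins suffice (`n ≤ |x|`, `b = n² + 2`).
[cite: BlaserIkenmeyerJindalLysikov2018, §6 (proof of Thm. 5, step 7)] -/
def coinPolyThm6 : Polynomial ℕ := Polynomial.X ^ 4 + Polynomial.C 2 * Polynomial.X ^ 2

/-- The dimension is at most the input length. [folklore] -/
private theorem nOf_le_length (x : List Bool) : KIReduction.nOf x ≤ x.length := by
  unfold KIReduction.nOf KIReduction.uStr
  have h1 := length_fstF_sndF_le x
  have h2 := length_fstF_sndF_le (fstF x)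
  have h3 := length_fstF_sndF_le (fstF (fstF x))
  have h4 := length_fstF_sndF_le (sndF (fstF (fstF x)))
  omega

/-- Enough coins: `n²(n²+2) ≤ N(|x|)`. [folklore] -/
private theorem coins_enough (x : List Bool) :
    KIReduction.nOf x * KIReduction.nOf x * bOf (KIReduction.nOf x) ≤ coinPolyThm6.eval x.length := by
  have h := nOf_le_length x
  simp only [coinPolyThm6, Polynomial.eval_add, Polynomial.eval_pow, Polynomial.eval_X, Polynomial.eval_mul,
    Polynomial.eval_C, bOf]
  have h2 : KIReduction.nOf x ^ 2 ≤ x.length ^ 2 := Nat.pow_le_pow_left h 2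
  have h4 : KIReduction.nOf x ^ 4 ≤ x.length ^ 4 := Nat.pow_le_pow_left h 4
  nlinarith

/-- **`L′ ∈ coRP`**: members are accepted on every coin string; a non-member is rejected with
probability `≥ 1/2` (one-sided error on the complement, `rp P`).
[cite: BlaserIkenmeyerJindalLysikov2018, Thm. 6 (proof, §6 p.19)] [cite: AroraBarakCC2009, Def. 7.6 and Lemma 7.5] -/
theorem semLang_mem_coRP : semLang ∈ coRP := by
  classical
  set L'' : Language Bool := {s | rejF s = [true]} with hL''
  have hrej1 : ∀ s, rejF s = [true] ∨ rejF s = [false] := fun s => by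
    rcases verifF'_oneBit s with h | h
    · exact Or.inr (by rw [rejF, notFn_apply h]; rfl)
    · exact Or.inl (by rw [rejF, notFn_apply h]; rfl)
  have hL''P : L'' ∈ Classes.P :=
    mem_P_of_mem_FP rejF_mem_FP L'' fun s => ⟨fun hs => hs, fun hs => (hrej1 s).resolve_left hs⟩
  change semLangᶜ ∈ RP
  refine ⟨L'', hL''P, coinPolyThm6, fun x => ⟨fun hx => ?_, fun hx y hy => ?_⟩⟩
  · -- `x ∉ L′`: rejected with probability `≥ 1/2`
    have hx' : x ∉ semLang := hx
    by_cases hwf : ∃ z pb W, x = boolPair z (boolPair pb W)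
    · obtain ⟨z, pb, W, rfl⟩ := hwf
      have hng : ¬ Good z pb W := fun hg => hx' ⟨z, pb, W, rfl, hg⟩
      have hacc := uniformProb_accept_le_half hng (coins_enough (boolPair z (boolPair pb W)))
      have hset : {y : List Bool | boolPair (boolPair z (boolPair pb W)) y ∈ L''} =
          {y | verifF (boolPair (boolPair z (boolPair pb W)) y) = [true]}ᶜ := by
        ext y
        change rejF (boolPair (boolPair z (boolPair pb W)) y) = [true] ↔ ¬ verifF (boolPair (boolPair z (boolPair pb W)) y) = [true]
        rw [rejF_eq_true_iff, verifF'_inst]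
        rcases verifF_oneBit (boolPair (boolPair z (boolPair pb W)) y) with h | h <;> simp [h]
      rw [hset, Literature.Computability.Complexity.uniformProb_compl]
      linarith
    · push Not at hwf
      have hall : ∀ y : List Bool, y.length = coinPolyThm6.eval x.length → y ∈ {y : List Bool | boolPair x y ∈ L''} :=
        fun y _ => (rejF_eq_true_iff _).2 (verifF'_of_not_wf (fun z pb W h => hwf z pb W h) y)
      rw [uniformProb_eq_cnt_div, cnt_eq_two_pow_of_forall hall]
      rw [Nat.cast_pow, Nat.cast_ofNat, div_self (by positivity)]
      norm_num
  · -- `x ∈ L′`: never rejected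
    have hx' : x ∈ semLang := not_not.1 hx
    obtain ⟨z, pb, W, rfl, hg⟩ := hx'
    change ¬ rejF (boolPair (boolPair z (boolPair pb W)) y) = [true]
    rw [rejF_eq_true_iff, verifF'_inst, verifF_accepts_of_good hg (by rw [hy]; exact coins_enough (boolPair z (boolPair pb W)))]
    simp

/-- **`L′ ∈ BPP`** (`coRP ⊆ BPP`). [cite: AroraBarakCC2009, §7.3] -/
theorem semLang_mem_BPP : semLang ∈ BPP :=
  ofLanguage_mem_PromiseBPP'_iff.1 (PromiseCoRP'_subset_PromiseBPP' (ofLanguage_mem_PromiseCoRP'_iff.2 semLang_mem_coRP))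

end Thm6Verifier

end Literature.Barriers.ValiantsHypothesis

end
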